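import Summits.SmoothPoincare4.SmoothPoincare4.Theorems.CylinderEntropySliceIsolationStubSeparationPersistsAux3
import Literature.Topology.FourManifolds.JordanBrouwerClosedHypersurface
import HarnessLib

/-!
# End-separation persists along a cylinder flow, part 4: the two sides of a cross-section (Jordan–Brouwer)

Part of the proof of the stub `stub_separationPersists` (END-SEPARATION PERSISTS ALONG A CYLINDER
FLOW) of line `conformal-kernel-domination` (closing chain γ) of the crux `CylinderEntropy.SliceIsolation`
(stmt-SmoothPoincare4-7632); see `CylinderEntropySliceIsolationStubSeparationPersists.lean` for the
overall argument. Everything here is proved (no named facts, no definitions: the tube chart is passed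
as a function `Ψ` with the hypothesis `hΨ` spelling it out, instantiated by `rfl`).

For a smooth embedding `ι` of a compact connected `4`-manifold `M` into `N = S⁴ × ℝ ⊂ ℝ⁶` with a
smooth unit normal `ν` tangent to `N`, and `t₀ > 0` such that the normalised push-offs
`nrm(ι x ± τ ν x)`, `0 < τ ≤ t₀`, miss `ι(M)`:

* `joinedIn_pushoff_or` — every point of `N ∖ ι(M)` is joined in `N ∖ ι(M)` to the `+ν` push-off
  `P₊ = nrm(ι x₀ + t₀ ν x₀)` or to the `-ν` push-off `P₋` (connectedness of `N`: the path component
  of a point joined to neither would be relatively clopen, as points of `N` near `ι(M)` are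
  push-offs by part 3);
* `not_joinedIn_pushoff` — **`P₊` and `P₋` are not joined in `N ∖ ι(M)`**: otherwise `N ∖ ι(M)` is
  path connected, and so is its image `ℝ⁵ ∖ ({0} ∪ K)` under the conformal diffeomorphism
  `Φ(z) = e^{z₅} z'` of `N` onto `ℝ⁵ ∖ {0}`, `K = Φ(ι M) ≅ M`; then `ℝ⁵ ∖ K` is connected,
  contradicting the tree's Jordan–Brouwer separation theorem for compact topological hypersurfaces
  of `ℝ⁵` (`Literature.Topology.FourManifolds.not_isPreconnected_compl_of_homeomorph_closedManifold`,
  Alexander duality with `ℤ/2` coefficients).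

## References

* M. W. Hirsch, *Differential Topology*, GTM 33 (1976), Ch. 4 §5 (tubular neighbourhoods), Ch. 8
  Thm. 1.3 (isotopy extension). [HirschDT1976]
* A. Hatcher, *Algebraic Topology*, CUP (2002), Prop. 3.46 (Jordan–Brouwer separation via Alexander
  duality). [HatcherAT2002]
-/

set_option linter.dupNamespace false

noncomputable section

open MeasureTheory Set Function Filter Module Asymptotics Metric
open scoped Manifold ContDiff ENNReal Topology RealInnerProductSpace NNReal

namespace Summit.SmoothPoincare4.SmoothPoincare4.Theorems.CylinderEntropySliceIsolation

open Summit.SmoothPoincare4.SmoothPoincare4.Theorems.CylinderRungTwo.KillingFlux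
open Literature.Geometry.Riemannian
open Literature.Geometry.Lorentzian Literature.Geometry.Lorentzian.PseudoRiemannianMetric
open Literature.Geometry.Riemannian.SphericalCylinderEntropy (truncL truncL_apply lipschitz_truncL)
open Literature.Geometry.Manifold.CylinderSlice (axis castSucc_ne_five padL padL_apply_castSucc
  padL_apply_last)

/-- `‖z'‖ = 1` on `N` (private copy of the tree's
`CylinderEntropySliceIsolationConformalMapLipschitz.norm_truncL_eq_one`, renamed and kept local to avoid importing
all of Mathlib through that module). [folklore] -/
private theorem norm_truncL_eq_one_of_mem_cyl {z : EuclideanSpace ℝ (Fin 6)} (hz : ∑ i : Fin 5, z (Fin.castSucc i) ^ 2 = 1) :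
    ‖truncL z‖ = 1 := by
  rw [← Real.sqrt_sq (norm_nonneg _), norm_truncL_sq, hz, Real.sqrt_one]

section Sides

variable {M : Type} [TopologicalSpace M] [ChartedSpace (EuclideanSpace ℝ (Fin 4)) M]
  [IsManifold (𝓡 4) ∞ M]

variable {ι ν : M → EuclideanSpace ℝ (Fin 6)}

/-- **Every point off the cross-section is joined to one of the two reference push-offs.**
If the normalised push-offs `nrm(ι x ± t ν x)`, `0 < t ≤ t₀`, miss `ι(M)`, then every point of
`N ∖ ι(M)` is joined in `N ∖ ι(M)` to `P₊ = nrm(ι x₀ + t₀ ν x₀)` or to `P₋ = nrm(ι x₀ - t₀ ν x₀)`: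
the set of points joined to a point `z` joined to neither is relatively clopen in the connected
`N` (open: short normalised segments; closed: its limit points off `ι(M)` are joined to it, and it
stays `δ` away from `ι(M)` because the points of `N` within `δ` of `ι(M)` are push-offs), and
misses `P₊`. [folklore] -/
theorem joinedIn_pushoff_or [T2Space M] [CompactSpace M] [ConnectedSpace M]
    (hι : Manifold.IsSmoothEmbedding (𝓡 4) (𝓡 6) ∞ ι)
    (hιN : ∀ x, ∑ i : Fin 5, ι x (Fin.castSucc i) ^ 2 = 1) (hνs : ContMDiff (𝓡 4) (𝓡 6) ∞ ν)
    (hνn : (euclideanMetric (EuclideanSpace ℝ (Fin 6))).IsUnitNormal (𝓡 4) ι ν 1)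
    (hνt : ∀ x, ∑ i : Fin 5, ν x (Fin.castSucc i) * ι x (Fin.castSucc i) = 0) {t₀ : ℝ} (ht₀ : 0 < t₀)
    (hpo : ∀ x, ∀ t ∈ Ioc (0 : ℝ) t₀,
      (fun z : EuclideanSpace ℝ (Fin 6) => (‖truncL z‖⁻¹ : ℝ) • (z - z (5 : Fin 6) •
        (axis : EuclideanSpace ℝ (Fin 6))) + z (5 : Fin 6) • (axis : EuclideanSpace ℝ (Fin 6))) (ι x + t • ν x) ∉ range ι ∧
      (fun z : EuclideanSpace ℝ (Fin 6) => (‖truncL z‖⁻¹ : ℝ) • (z - z (5 : Fin 6) •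
        (axis : EuclideanSpace ℝ (Fin 6))) + z (5 : Fin 6) • (axis : EuclideanSpace ℝ (Fin 6))) (ι x + t • (-ν x)) ∉ range ι)
    (x₀ : M) {z : EuclideanSpace ℝ (Fin 6)}
    (hz : z ∈ (({z : EuclideanSpace ℝ (Fin 6) | ∑ i : Fin 5, z (Fin.castSucc i) ^ 2 = 1} :
        Set (EuclideanSpace ℝ (Fin 6))) \ range ι)) :
    JoinedIn (({z : EuclideanSpace ℝ (Fin 6) | ∑ i : Fin 5, z (Fin.castSucc i) ^ 2 = 1} :
        Set (EuclideanSpace ℝ (Fin 6))) \ range ι) z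
      ((fun z : EuclideanSpace ℝ (Fin 6) => (‖truncL z‖⁻¹ : ℝ) • (z - z (5 : Fin 6) •
        (axis : EuclideanSpace ℝ (Fin 6))) + z (5 : Fin 6) • (axis : EuclideanSpace ℝ (Fin 6))) (ι x₀ + t₀ • ν x₀)) ∨
    JoinedIn (({z : EuclideanSpace ℝ (Fin 6) | ∑ i : Fin 5, z (Fin.castSucc i) ^ 2 = 1} :
        Set (EuclideanSpace ℝ (Fin 6))) \ range ι) z
      ((fun z : EuclideanSpace ℝ (Fin 6) => (‖truncL z‖⁻¹ : ℝ) • (z - z (5 : Fin 6) •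
        (axis : EuclideanSpace ℝ (Fin 6))) + z (5 : Fin 6) • (axis : EuclideanSpace ℝ (Fin 6))) (ι x₀ + t₀ • (-ν x₀))) := by
  haveI : Nonempty M := ⟨x₀⟩
  by_contra H
  push Not at H
  obtain ⟨HP, HM⟩ := H
  have hνc : Continuous ν := hνs.continuous
  have hνt' : ∀ x, ∑ i : Fin 5, (-ν x) (Fin.castSucc i) * ι x (Fin.castSucc i) = 0 := fun x => by
    simp only [PiLp.neg_apply, neg_mul, Finset.sum_neg_distrib, hνt x, neg_zero]
  -- notation
  set Ncyl : Set (EuclideanSpace ℝ (Fin 6)) := {z : EuclideanSpace ℝ (Fin 6) | ∑ i : Fin 5, z (Fin.castSucc i) ^ 2 = 1}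
    with hNcyl
  set C : Set (EuclideanSpace ℝ (Fin 6)) := {w | JoinedIn (Ncyl \ range ι) z w} with hC
  have hzC : z ∈ C := JoinedIn.refl hz
  have hCsub : C ⊆ Ncyl \ range ι := fun w hw => hw.target_mem
  -- points of `N` within `δ` of the cross-section are push-offs with `|r| < t₀`
  obtain ⟨δ, hδ, hpush⟩ := exists_pushoff_of_infDist_lt hι hιN hνs hνn hνt ht₀
  -- (d) `C` stays `δ` away from `ι(M)`
  have hfar : ∀ w ∈ C, δ ≤ infDist w (range ι) := by
    intro w hw
    by_contra hlt
    push Not at hlt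
    obtain ⟨x, r, hr, hwr⟩ := hpush w (hCsub hw).1 hlt
    rcases lt_trichotomy r 0 with hneg | hzero | hpos
    · apply HM
      have hwr' : w = (fun z : EuclideanSpace ℝ (Fin 6) => (‖truncL z‖⁻¹ : ℝ) • (z - z (5 : Fin 6) •
          (axis : EuclideanSpace ℝ (Fin 6))) + z (5 : Fin 6) • (axis : EuclideanSpace ℝ (Fin 6))) (ι x + (-r) • (-ν x)) := by
        rw [hwr, neg_smul_neg]
      have hmem : -r ∈ Ioc (0 : ℝ) t₀ := ⟨by linarith, by rw [abs_lt] at hr; linarith [hr.1]⟩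
      have hj := joinedIn_pushoffs_of_notMem (τ := fun x => -ν x) hι hιN hνc.neg hνt' ht₀
        (fun x t ht => (hpo x t ht).2) x hmem x₀ ⟨ht₀, le_rfl⟩
      rw [← hwr'] at hj
      exact hw.trans hj
    · exact (hCsub hw).2 ⟨x, by rw [hwr, hzero, zero_smul, add_zero]; exact (nrm_eq_self (hιN x)).symm⟩
    · apply HP
      have hmem : r ∈ Ioc (0 : ℝ) t₀ := ⟨hpos, (abs_lt.1 hr).2.le⟩
      have hj := joinedIn_pushoffs_of_notMem hι hιN hνc hνt ht₀ (fun x t ht => (hpo x t ht).1) x hmem x₀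
        ⟨ht₀, le_rfl⟩
      rw [← hwr] at hj
      exact hw.trans hj
  -- short segments from a point of `N ∖ ι(M)` stay in `N ∖ ι(M)`
  have hseg : ∀ w ∈ Ncyl, ∀ w' ∈ Ncyl, ‖w' - w‖ < 1 / 2 → 2 * ‖w' - w‖ < infDist w (range ι) →
      JoinedIn (Ncyl \ range ι) w w' := by
    intro w hw w' hw' h1 h2
    refine (joinedIn_nrm_segment hw hw' h1).mono ?_
    rintro y ⟨hyN, hyd⟩
    refine ⟨hyN, fun hyS => ?_⟩
    have := infDist_le_dist_of_mem hyS (x := w)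
    rw [dist_comm, dist_eq_norm] at this
    linarith
  -- the two open sets
  set η : ℝ := min (δ / 4) (1 / 4) with hη
  have hη0 : 0 < η := lt_min (by positivity) (by norm_num)
  set u : Set (EuclideanSpace ℝ (Fin 6)) := ⋃ w ∈ C, ball w η with hu
  have huo : IsOpen u := isOpen_biUnion fun _ _ => isOpen_ball
  set D : Set (EuclideanSpace ℝ (Fin 6)) := (Ncyl \ range ι) \ C with hD
  set v : Set (EuclideanSpace ℝ (Fin 6)) := {w | infDist w (range ι) < δ} ∪
    ⋃ w ∈ D, ball w (min (infDist w (range ι) / 4) (1 / 4)) with hv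
  have hvo : IsOpen v :=
    (isOpen_lt (continuous_infDist_pt _) continuous_const).union (isOpen_biUnion fun _ _ => isOpen_ball)
  -- `u ∩ N ⊆ C`
  have huC : ∀ w' ∈ Ncyl, w' ∈ u → w' ∈ C := by
    intro w' hw' hw'u
    rw [hu, mem_iUnion₂] at hw'u
    obtain ⟨w, hwC, hww⟩ := hw'u
    rw [mem_ball_iff_norm] at hww
    have h1 : ‖w' - w‖ < 1 / 2 := by linarith [min_le_right (δ / 4) (1 / 4)]
    have h2 : 2 * ‖w' - w‖ < infDist w (range ι) := by
      linarith [min_le_left (δ / 4) (1 / 4), hfar w hwC]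
    exact hwC.trans (hseg w (hCsub hwC).1 w' hw' h1 h2)
  -- cover, nonempty pieces, disjointness on `N`
  have hcover : Ncyl ⊆ u ∪ v := by
    intro w hw
    by_cases hwC : w ∈ C
    · exact Or.inl (mem_iUnion₂.2 ⟨w, hwC, mem_ball_self hη0⟩)
    by_cases hwS : w ∈ range ι
    · refine Or.inr (Or.inl ?_)
      show infDist w (range ι) < δ
      rw [infDist_zero_of_mem hwS]; exact hδ
    · have hwD : w ∈ D := ⟨⟨hw, hwS⟩, hwC⟩
      have hpos : 0 < infDist w (range ι) := by
        rw [← (isCompact_range hι.contMDiff.continuous).isClosed.notMem_iff_infDist_pos (range_nonempty ι)]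
        exact hwS
      exact Or.inr (Or.inr (mem_iUnion₂.2 ⟨w, hwD, mem_ball_self (lt_min (by positivity) (by norm_num))⟩))
  have hPmem : (fun z : EuclideanSpace ℝ (Fin 6) => (‖truncL z‖⁻¹ : ℝ) • (z - z (5 : Fin 6) •
      (axis : EuclideanSpace ℝ (Fin 6))) + z (5 : Fin 6) • (axis : EuclideanSpace ℝ (Fin 6))) (ι x₀ + t₀ • ν x₀) ∈
      Ncyl \ range ι := nrm_pushoff_mem hιN (hνt x₀) (hpo x₀ t₀ ⟨ht₀, le_rfl⟩).1
  have hPD : (fun z : EuclideanSpace ℝ (Fin 6) => (‖truncL z‖⁻¹ : ℝ) • (z - z (5 : Fin 6) •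
      (axis : EuclideanSpace ℝ (Fin 6))) + z (5 : Fin 6) • (axis : EuclideanSpace ℝ (Fin 6))) (ι x₀ + t₀ • ν x₀) ∈ D :=
    ⟨hPmem, HP⟩
  have hune : (Ncyl ∩ u).Nonempty := ⟨z, hz.1, mem_iUnion₂.2 ⟨z, hzC, mem_ball_self hη0⟩⟩
  have hvne : (Ncyl ∩ v).Nonempty := by
    refine ⟨_, hPmem.1, Or.inr (mem_iUnion₂.2 ⟨_, hPD, mem_ball_self (lt_min ?_ (by norm_num))⟩)⟩
    have hpos : 0 < infDist ((fun z : EuclideanSpace ℝ (Fin 6) => (‖truncL z‖⁻¹ : ℝ) • (z - z (5 : Fin 6) •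
      (axis : EuclideanSpace ℝ (Fin 6))) + z (5 : Fin 6) • (axis : EuclideanSpace ℝ (Fin 6))) (ι x₀ + t₀ • ν x₀)) (range ι) := by
      rw [← (isCompact_range hι.contMDiff.continuous).isClosed.notMem_iff_infDist_pos (range_nonempty ι)]
      exact hPmem.2
    positivity
  obtain ⟨w₀, hw₀N, hw₀u, hw₀v⟩ := isPreconnected_cylN u v huo hvo hcover hune hvne
  have hw₀C : w₀ ∈ C := huC w₀ hw₀N hw₀u
  rcases hw₀v with hw₀near | hw₀D
  · exact absurd (hfar w₀ hw₀C) (not_le.2 hw₀near)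
  · rw [mem_iUnion₂] at hw₀D
    obtain ⟨w, hwD, hww⟩ := hw₀D
    rw [mem_ball_iff_norm] at hww
    have h1 : ‖w₀ - w‖ < 1 / 2 := by linarith [min_le_right (infDist w (range ι) / 4) (1 / 4)]
    have h2 : 2 * ‖w₀ - w‖ < infDist w (range ι) := by
      have := min_le_left (infDist w (range ι) / 4) (1 / 4)
      have hpos : 0 < infDist w (range ι) := by
        rw [← (isCompact_range hι.contMDiff.continuous).isClosed.notMem_iff_infDist_pos (range_nonempty ι)]
        exact hwD.1.2
      linarith
    exact hwD.2 (hw₀C.trans (hseg w hwD.1.1 w₀ hw₀N h1 h2).symm)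

end Sides

/-! ## §3 The two reference push-offs are not joined: Jordan–Brouwer via the conformal map -/

section JordanBrouwer

/-- The conformal map `Φ(z) = e^{z₅} z'` of `ℝ⁶ ⊃ N` to `ℝ⁵` is injective on `N`. [folklore] -/
theorem conformal_injOn {z z' : EuclideanSpace ℝ (Fin 6)}
    (hz : ∑ i : Fin 5, z (Fin.castSucc i) ^ 2 = 1) (hz' : ∑ i : Fin 5, z' (Fin.castSucc i) ^ 2 = 1)
    (h : Real.exp (z 5) • truncL z = Real.exp (z' 5) • truncL z') : z = z' := by
  have hn := congrArg norm h
  rw [norm_smul, norm_smul, norm_truncL_eq_one_of_mem_cyl hz, norm_truncL_eq_one_of_mem_cyl hz', mul_one, mul_one,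
    Real.norm_of_nonneg (Real.exp_pos _).le, Real.norm_of_nonneg (Real.exp_pos _).le, Real.exp_eq_exp] at hn
  rw [hn] at h
  have htr : truncL z = truncL z' := smul_right_injective _ (Real.exp_pos _).ne' h
  rw [eq_vert z, eq_vert z', htr, hn]

/-- The conformal map `Φ(z) = e^{z₅} z'` maps `N` onto `ℝ⁵ ∖ {0}`: an explicit preimage.
[folklore] -/
theorem conformal_preimage {y : EuclideanSpace ℝ (Fin 5)} (hy : y ≠ 0) :
    ∑ i : Fin 5, (padL (‖y‖⁻¹ • y) + Real.log ‖y‖ • (axis : EuclideanSpace ℝ (Fin 6))) (Fin.castSucc i) ^ 2 = 1 ∧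
    Real.exp ((padL (‖y‖⁻¹ • y) + Real.log ‖y‖ • (axis : EuclideanSpace ℝ (Fin 6))) 5) •
      truncL (padL (‖y‖⁻¹ • y) + Real.log ‖y‖ • (axis : EuclideanSpace ℝ (Fin 6))) = y := by
  have hny : 0 < ‖y‖ := norm_pos_iff.2 hy
  have hp : ∑ i : Fin 5, (‖y‖⁻¹ • y) i ^ 2 = 1 :=
    sum_sq_of_norm_eq_one (by rw [norm_smul, norm_inv, norm_norm, inv_mul_cancel₀ hny.ne'])
  refine ⟨vert_mem_Ncyl hp _, ?_⟩
  rw [vert_apply_five, truncL_vert, Real.exp_log hny, smul_smul, mul_inv_cancel₀ hny.ne', one_smul]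

variable {M : Type} [TopologicalSpace M] [ChartedSpace (EuclideanSpace ℝ (Fin 4)) M]
  [IsManifold (𝓡 4) ∞ M]

variable {ι ν : M → EuclideanSpace ℝ (Fin 6)}

/-- **The two sides of a connected closed cross-section are different** (Jordan–Brouwer): under the
hypotheses of `joinedIn_pushoff_or`, the reference push-offs `P₊ = nrm(ι x₀ + t₀ ν x₀)` and
`P₋ = nrm(ι x₀ - t₀ ν x₀)` are NOT joined in `N ∖ ι(M)`.  Otherwise `N ∖ ι(M)` is path connected
(`joinedIn_pushoff_or`); its image under the conformal diffeomorphism `Φ(z) = e^{z₅} z'` of `N` onto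
`ℝ⁵ ∖ {0}` is `ℝ⁵ ∖ ({0} ∪ K)`, `K = Φ(ι M)`, so `ℝ⁵ ∖ K ⊆ closure(ℝ⁵ ∖ ({0} ∪ K))` is connected —
contradicting the Jordan–Brouwer separation theorem for the compact topological hypersurface
`K ≅ M` of `ℝ⁵` (tree: `not_isPreconnected_compl_of_homeomorph_closedManifold`, Alexander duality
with `ℤ/2` coefficients). [cite: HatcherAT2002, Prop. 3.46] -/
theorem not_joinedIn_pushoff [T2Space M] [CompactSpace M] [ConnectedSpace M]
    (hι : Manifold.IsSmoothEmbedding (𝓡 4) (𝓡 6) ∞ ι)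
    (hιN : ∀ x, ∑ i : Fin 5, ι x (Fin.castSucc i) ^ 2 = 1) (hνs : ContMDiff (𝓡 4) (𝓡 6) ∞ ν)
    (hνn : (euclideanMetric (EuclideanSpace ℝ (Fin 6))).IsUnitNormal (𝓡 4) ι ν 1)
    (hνt : ∀ x, ∑ i : Fin 5, ν x (Fin.castSucc i) * ι x (Fin.castSucc i) = 0) {t₀ : ℝ} (ht₀ : 0 < t₀)
    (hpo : ∀ x, ∀ t ∈ Ioc (0 : ℝ) t₀,
      (fun z : EuclideanSpace ℝ (Fin 6) => (‖truncL z‖⁻¹ : ℝ) • (z - z (5 : Fin 6) •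
        (axis : EuclideanSpace ℝ (Fin 6))) + z (5 : Fin 6) • (axis : EuclideanSpace ℝ (Fin 6))) (ι x + t • ν x) ∉ range ι ∧
      (fun z : EuclideanSpace ℝ (Fin 6) => (‖truncL z‖⁻¹ : ℝ) • (z - z (5 : Fin 6) •
        (axis : EuclideanSpace ℝ (Fin 6))) + z (5 : Fin 6) • (axis : EuclideanSpace ℝ (Fin 6))) (ι x + t • (-ν x)) ∉ range ι)
    (x₀ : M) :
    ¬ JoinedIn (({z : EuclideanSpace ℝ (Fin 6) | ∑ i : Fin 5, z (Fin.castSucc i) ^ 2 = 1} :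
        Set (EuclideanSpace ℝ (Fin 6))) \ range ι)
      ((fun z : EuclideanSpace ℝ (Fin 6) => (‖truncL z‖⁻¹ : ℝ) • (z - z (5 : Fin 6) •
        (axis : EuclideanSpace ℝ (Fin 6))) + z (5 : Fin 6) • (axis : EuclideanSpace ℝ (Fin 6))) (ι x₀ + t₀ • ν x₀))
      ((fun z : EuclideanSpace ℝ (Fin 6) => (‖truncL z‖⁻¹ : ℝ) • (z - z (5 : Fin 6) •
        (axis : EuclideanSpace ℝ (Fin 6))) + z (5 : Fin 6) • (axis : EuclideanSpace ℝ (Fin 6))) (ι x₀ + t₀ • (-ν x₀))) := by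
  intro hJ
  have hιc : Continuous ι := hι.contMDiff.continuous
  set Ncyl : Set (EuclideanSpace ℝ (Fin 6)) := {z : EuclideanSpace ℝ (Fin 6) | ∑ i : Fin 5, z (Fin.castSucc i) ^ 2 = 1}
    with hNcyl
  -- `N ∖ ι(M)` is path connected
  have hPmem : (fun z : EuclideanSpace ℝ (Fin 6) => (‖truncL z‖⁻¹ : ℝ) • (z - z (5 : Fin 6) •
      (axis : EuclideanSpace ℝ (Fin 6))) + z (5 : Fin 6) • (axis : EuclideanSpace ℝ (Fin 6))) (ι x₀ + t₀ • ν x₀) ∈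
      Ncyl \ range ι := nrm_pushoff_mem hιN (hνt x₀) (hpo x₀ t₀ ⟨ht₀, le_rfl⟩).1
  have hpc : IsPathConnected (Ncyl \ range ι) := by
    refine ⟨_, hPmem, fun w hw => ?_⟩
    rcases joinedIn_pushoff_or hι hιN hνs hνn hνt ht₀ hpo x₀ hw with h | h
    · exact h.symm
    · exact hJ.trans h.symm
  -- the conformal map and the image
  set Φc : EuclideanSpace ℝ (Fin 6) → EuclideanSpace ℝ (Fin 5) := fun z => Real.exp (z 5) • truncL z with hΦc
  have hΦcc : Continuous Φc := by
    have h5 : Continuous fun z : EuclideanSpace ℝ (Fin 6) => z (5 : Fin 6) := (EuclideanSpace.proj (5 : Fin 6)).continuous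
    exact (Real.continuous_exp.comp h5).smul truncL.continuous
  set K : Set (EuclideanSpace ℝ (Fin 5)) := range (Φc ∘ ι) with hK
  have hKc : IsCompact K := isCompact_range (hΦcc.comp hιc)
  set A : Set (EuclideanSpace ℝ (Fin 5)) := Φc '' (Ncyl \ range ι) with hA
  have hApc : IsPathConnected A := hpc.image' hΦcc.continuousOn
  -- `A ⊆ Kᶜ ⊆ closure A`
  have hAK : A ⊆ Kᶜ := by
    rintro _ ⟨w, ⟨hwN, hwS⟩, rfl⟩ ⟨x, hx⟩
    exact hwS ⟨x, conformal_injOn (hιN x) hwN hx⟩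
  have hmemA : ∀ y : EuclideanSpace ℝ (Fin 5), y ≠ 0 → y ∉ K → y ∈ A := by
    intro y hy hyK
    obtain ⟨hzN, hzy⟩ := conformal_preimage hy
    refine ⟨_, ⟨hzN, ?_⟩, hzy⟩
    rintro ⟨x, hx⟩
    exact hyK ⟨x, by simp only [comp_apply, hx]; exact hzy⟩
  have hKcl : Kᶜ ⊆ closure A := by
    intro y hyK
    by_cases hy : y = 0
    · subst hy
      obtain ⟨r₀, hr₀, hball⟩ := Metric.isOpen_iff.1 hKc.isClosed.isOpen_compl 0 hyK
      rw [Metric.mem_closure_iff]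
      intro ε hε
      set b : EuclideanSpace ℝ (Fin 5) := (min ε r₀ / 2) • EuclideanSpace.single (0 : Fin 5) (1 : ℝ) with hb
      have hbn : ‖b‖ = min ε r₀ / 2 := by
        rw [hb, norm_smul, PiLp.norm_single, norm_one, mul_one, Real.norm_of_nonneg (by positivity)]
      have hb0 : b ≠ 0 := by
        rw [← norm_ne_zero_iff, hbn]; positivity
      refine ⟨b, hmemA b hb0 (hball ?_), ?_⟩
      · rw [mem_ball, dist_zero_right, hbn]
        linarith [min_le_right ε r₀, lt_min hε hr₀]
      · rw [dist_comm, dist_zero_right, hbn]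
        linarith [min_le_left ε r₀, lt_min hε hr₀]
    · exact subset_closure (hmemA y hy hyK)
  have hpre : IsPreconnected Kᶜ := hApc.isConnected.isPreconnected.subset_closure hAK hKcl
  -- `K ≅ M`
  set f : M → K := fun x => ⟨Φc (ι x), ⟨x, rfl⟩⟩ with hf
  have hfc : Continuous f := (hΦcc.comp hιc).subtype_mk _
  have hfb : Bijective f := by
    constructor
    · intro x x' h
      have h' : Φc (ι x) = Φc (ι x') := congrArg Subtype.val h
      exact hι.isEmbedding.injective (conformal_injOn (hιN x) (hιN x') h')
    · rintro ⟨_, ⟨x, rfl⟩⟩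
      exact ⟨x, rfl⟩
  have φ : M ≃ₜ K := Continuous.homeoOfEquivCompactToT2 (f := Equiv.ofBijective f hfb) hfc
  exact Literature.Topology.FourManifolds.not_isPreconnected_compl_of_homeomorph_closedManifold
    (d := 4) (n := 5) rfl (by norm_num) hKc φ hpre

end JordanBrouwer

/-- Marker of this part (registered sub-goal `helper_sepPersistsConformalInj` of stmt-SmoothPoincare4-7632): the conformal map `Φ(z) = e^{z₅} z'` is injective on `N` (`conformal_injOn`, the transfer of the complement of a cross-section to the complement of a compact hypersurface of `ℝ⁵`). [folklore] -/
theorem helper_sepPersistsConformalInj :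
    ∀ z z' : EuclideanSpace ℝ (Fin 6), (∑ i : Fin 5, z (Fin.castSucc i) ^ 2 = 1) → (∑ i : Fin 5, z' (Fin.castSucc i) ^ 2 = 1) → Real.exp (z 5) • Literature.Geometry.Riemannian.SphericalCylinderEntropy.truncL z = Real.exp (z' 5) • Literature.Geometry.Riemannian.SphericalCylinderEntropy.truncL z' → z = z' :=
  fun _ _ hz hz' h => conformal_injOn hz hz' h

end Summit.SmoothPoincare4.SmoothPoincare4.Theorems.CylinderEntropySliceIsolation
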